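import Mathlib
import Summits.AtomisticToContinuum.Crystallization.Theorems.ChargedEnergyGap.Negative.Unconditional
import HarnessLib

/-! # Path count (connectivity ⇒ linear growth of particle-centred balls) — stub `stub_pathCount` of line `Sketch`, crux `LjLaminarWindows` (stmt-AtomisticToContinuum-6711) -/

noncomputable section

open scoped BigOperators
open Summit.AtomisticToContinuum.Crystallization.Theorems.ChargedEnergyGapNegative

namespace Summit.AtomisticToContinuum.Crystallization.Theorems.LjLaminarWindowsSketch

/-- **Ball growth by one particle per `ρ`-step.**  If the configuration `x` is `ρ`-connected (every
non-empty proper group of particles has a member within `ρ` of a non-member) and some particle lies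
beyond distance `L` from `x i`, then for every `m : ℕ` with `m ρ ≤ L` the closed `m ρ`-ball around
`x i` holds at least `m + 1` particles: the `m ρ`-ball is a non-empty proper group, so connectivity
and the triangle inequality put a new particle into the `(m + 1) ρ`-ball. [folklore] -/
theorem pathCount_ballGrowth {N : ℕ} (x : Fin N → E3) {ρ : ℝ} (hρ : 0 < ρ)
    (hconn : ∀ S : Finset (Fin N), S.Nonempty → Sᶜ.Nonempty →
      ∃ p ∈ S, ∃ k ∈ Sᶜ, dist (x p) (x k) ≤ ρ)
    (i : Fin N) {L : ℝ} (hfar : ∃ j : Fin N, L < dist (x j) (x i)) :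
    ∀ m : ℕ, (m : ℝ) * ρ ≤ L →
      m + 1 ≤ (Finset.univ.filter fun j : Fin N => dist (x j) (x i) ≤ (m : ℝ) * ρ).card := by
  obtain ⟨j₀, hj₀⟩ := hfar
  intro m
  induction m with
  | zero =>
    intro _
    have hi : i ∈ Finset.univ.filter (fun j : Fin N => dist (x j) (x i) ≤ ((0 : ℕ) : ℝ) * ρ) := by
      simp
    have hpos := Finset.card_pos.2 ⟨i, hi⟩
    omega
  | succ m ih =>
    intro hmL
    have hcast : ((m + 1 : ℕ) : ℝ) * ρ = (m : ℝ) * ρ + ρ := by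
      push_cast
      ring
    rw [hcast] at hmL ⊢
    have hm : (m : ℝ) * ρ ≤ L := by linarith
    -- `A` = the `m ρ`-ball, `B` = the `(m + 1) ρ`-ball (as groups of particle indices).
    set A : Finset (Fin N) :=
      Finset.univ.filter fun j : Fin N => dist (x j) (x i) ≤ (m : ℝ) * ρ with hA
    set B : Finset (Fin N) :=
      Finset.univ.filter fun j : Fin N => dist (x j) (x i) ≤ (m : ℝ) * ρ + ρ with hB
    have hiA : i ∈ A := by
      refine Finset.mem_filter.2 ⟨Finset.mem_univ _, ?_⟩
      rw [dist_self]
      positivity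
    have hj₀A : j₀ ∈ Aᶜ := by
      refine Finset.mem_compl.2 fun h => ?_
      have h' : dist (x j₀) (x i) ≤ (m : ℝ) * ρ := (Finset.mem_filter.1 h).2
      linarith
    obtain ⟨p, hp, k, hk, hpk⟩ := hconn A ⟨i, hiA⟩ ⟨j₀, hj₀A⟩
    have hpA : dist (x p) (x i) ≤ (m : ℝ) * ρ := (Finset.mem_filter.1 hp).2
    have hkA : ¬ dist (x k) (x i) ≤ (m : ℝ) * ρ := fun h =>
      (Finset.mem_compl.1 hk) (Finset.mem_filter.2 ⟨Finset.mem_univ _, h⟩)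
    have hkB : k ∈ B := by
      refine Finset.mem_filter.2 ⟨Finset.mem_univ _, ?_⟩
      calc dist (x k) (x i) ≤ dist (x k) (x p) + dist (x p) (x i) := dist_triangle _ _ _
        _ ≤ ρ + (m : ℝ) * ρ := by rw [dist_comm]; exact add_le_add hpk hpA
        _ = (m : ℝ) * ρ + ρ := by ring
    have hAB : A ⊆ B :=
      Finset.monotone_filter_right _ fun j _ hj => by linarith [hj]
    have hssub : A ⊂ B :=
      (Finset.ssubset_iff_of_subset hAB).2 ⟨k, hkB, fun h => hkA (Finset.mem_filter.1 h).2⟩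
    have hlt := Finset.card_lt_card hssub
    have hih := ih hm
    omega

/-- **C5e — path count (connectivity ⇒ linear ball growth).**  If the configuration `x` is
`ρ`-connected (every non-empty proper group `S` of particles has a member within `ρ` of a
non-member) and some particle lies beyond distance `L ≥ 0` from `x i`, then the closed `L`-ball
around `x i` holds at least `L / ρ` particles: with `m = ⌊L / ρ⌋₊` the `m ρ`-ball already holds
`m + 1 > L / ρ` of them (`pathCount_ballGrowth`). [folklore] -/
theorem stub_pathCount :
    ∀ (N : ℕ) (x : Fin N → E3) (ρ : ℝ), 0 < ρ →
      (∀ S : Finset (Fin N), S.Nonempty → Sᶜ.Nonempty → ∃ p ∈ S, ∃ k ∈ Sᶜ, dist (x p) (x k) ≤ ρ) →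
      ∀ (i : Fin N) (L : ℝ), 0 ≤ L → (∃ j : Fin N, L < dist (x j) (x i)) →
        L / ρ ≤ ((Finset.univ.filter fun j : Fin N => dist (x j) (x i) ≤ L).card : ℝ) := by
  intro N x ρ hρ hconn i L hL hfar
  have hLρ : 0 ≤ L / ρ := div_nonneg hL hρ.le
  have hmρ : (⌊L / ρ⌋₊ : ℝ) * ρ ≤ L := by
    have h := Nat.floor_le hLρ
    rwa [le_div_iff₀ hρ] at h
  have hgrow := pathCount_ballGrowth x hρ hconn i hfar ⌊L / ρ⌋₊ hmρ
  have hsub : (Finset.univ.filter fun j : Fin N => dist (x j) (x i) ≤ (⌊L / ρ⌋₊ : ℝ) * ρ) ⊆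
      Finset.univ.filter fun j : Fin N => dist (x j) (x i) ≤ L :=
    Finset.monotone_filter_right _ fun j _ hj => hj.trans hmρ
  have h1 : (⌊L / ρ⌋₊ : ℝ) + 1 ≤
      ((Finset.univ.filter fun j : Fin N => dist (x j) (x i) ≤ L).card : ℝ) := by
    have h := hgrow.trans (Finset.card_le_card hsub)
    exact_mod_cast h
  have hlt : L / ρ < (⌊L / ρ⌋₊ : ℝ) + 1 := Nat.lt_floor_add_one _
  linarith

end Summit.AtomisticToContinuum.Crystallization.Theorems.LjLaminarWindowsSketch

end
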